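import Mathlib.Analysis.Convex.Slope
import Mathlib.Analysis.Calculus.Deriv.Basic
import Summits.HubbardSuperconductivity.HubbardSuperconductivity.Theorems.ThermalWedgeTwSeededEnsembleEquivalenceSeededLimitOfSourcedLimit
import Summits.HubbardSuperconductivity.HubbardSuperconductivity.Theorems.ThermalWedgeTwApproximatingHamiltonian
import Summits.HubbardSuperconductivity.HubbardSuperconductivity.Theorems.ThermalWedgeTwSeededEnsembleEquivalenceRSourcedPressureBasics

/-!
# Crux `TwSeededEnsembleEquivalenceR` (stmt-HubbardSuperconductivity-15581), line `cold-floor-collapse`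
# (slug `Sketch`) — stub S5 `stub_coldAssembly`: the cold assembly (glue)

Support file (`--supports stmt-HubbardSuperconductivity-15581`; sorry-free; no definition).
S3 (thermodynamic limit of the SOURCED pressure, pointwise) → S1 (convex Danskin envelope theorem) →
S4 (cold-slice regularity of the sourced limit at its optimal sources) → the COLD differentiable-pressure
input of the crux (hypothesis `hP` of `ColdFloor.twR_of_coldDifferentiablePressure`: (TDL)+(DIFF)+(EDGE) of
the SEEDED pressure at the one inverse temperature `β = e^{a/U}`).

Proof: choose the sourced limit `q` globally (S3); the approximating-Hamiltonian theorem (item 1703,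
`twApproximatingHamiltonian_proof`) with `tw_seededPressureLimit_of_sourcedLimit` gives the seeded limit
`b μ = sSup_{|h| ≤ 13g+1} [q μ h − h²/g]` (TDL); convexity in `μ` and the Lipschitz bounds `2|μ−μ'|`
(`…RSourcedPressureBasics`), `8√2|h−h'|` (`abs_sourcedPressure_sub_le`) pass to the limit; S1 with S4's
common slopes gives `HasDerivAt b d μ` on `(μ₁, μ₂)` (DIFF) and `deriv b μm = dm ≤ 1 − δ ≤ dp = deriv b μp`
(EDGE). [folklore composition]
-/

set_option linter.dupNamespace false

namespace Summit.HubbardSuperconductivity.HubbardSuperconductivity.Theorems.TwSeededEnsembleEquivalenceR.ColdFloorLine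

open Matrix Filter Topology Finset Literature.MathematicalPhysics.QuantumLattice
open Summit.HubbardSuperconductivity.HubbardSuperconductivity.Theorems.TwSeededEnsembleEquivalence.ThermalDuality
open scoped ComplexOrder Matrix.Norms.L2Operator

noncomputable section

/-! ### The glue -/

/-- **S5 (registered stub of line `Sketch`, crux stmt-HubbardSuperconductivity-15581): the cold assembly.**
S3 → S1 → S4 → the cold differentiable-pressure input (TDL)+(DIFF)+(EDGE) of the seeded pressure at
`β = e^{a/U}` (hypothesis `hP` of `twR_of_coldDifferentiablePressure`). [folklore composition] -/
theorem stub_coldAssembly :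
    (∀ (β U μ h : ℝ), 0 < β → ∃ q : ℝ, ∀ κ : ℝ, 0 < κ → ∃ L₀ : ℕ, ∀ (L : ℕ) [NeZero L], L₀ ≤ L →
      |Real.log (Matrix.partitionFn β (dWaveSourceTorus L U μ h)).re / (β * (L : ℝ) ^ 2) - q| ≤ κ) →
    (∀ (q : ℝ → ℝ → ℝ) (H g Cμ Ch μ₀ d : ℝ), 0 ≤ H →
      (∀ h ∈ Set.Icc (-H) H, ConvexOn ℝ Set.univ (fun μ => q μ h)) →
      (∀ (μ μ' : ℝ), ∀ h ∈ Set.Icc (-H) H, |q μ h - q μ' h| ≤ Cμ * |μ - μ'|) →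
      (∀ (μ : ℝ), ∀ h ∈ Set.Icc (-H) H, ∀ h' ∈ Set.Icc (-H) H, |q μ h - q μ h'| ≤ Ch * |h - h'|) →
      (∀ h ∈ Set.Icc (-H) H,
        q μ₀ h - h ^ 2 / g = sSup ((fun h' : ℝ => q μ₀ h' - h' ^ 2 / g) '' Set.Icc (-H) H) →
          HasDerivAt (fun μ => q μ h) d μ₀) →
      HasDerivAt (fun μ => sSup ((fun h' : ℝ => q μ h' - h' ^ 2 / g) '' Set.Icc (-H) H)) d μ₀) →
    (∀ δ ∈ Set.Icc (1/10 : ℝ) (2/5 : ℝ), ∃ μ₁ μ₂ : ℝ, -4 < μ₁ ∧ μ₁ < μ₂ ∧ μ₂ < 0 ∧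
      ∃ a K' U₀ : ℝ, 0 < a ∧ 0 < K' ∧ 0 < U₀ ∧ ∀ U ∈ Set.Ioc (0 : ℝ) U₀,
        ∀ g ∈ Set.Icc (K' * U) (1 / 10), ∀ q : ℝ → ℝ → ℝ,
          (∀ μ ∈ Set.Icc μ₁ μ₂, ∀ h ∈ Set.Icc (-(13 * g + 1)) (13 * g + 1), ∀ κ : ℝ, 0 < κ →
            ∃ L₀ : ℕ, ∀ (L : ℕ) [NeZero L], L₀ ≤ L →
              |Real.log (Matrix.partitionFn (Real.exp (a / U)) (dWaveSourceTorus L U μ h)).re /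
                  (Real.exp (a / U) * (L : ℝ) ^ 2) - q μ h| ≤ κ) →
          (∀ μ ∈ Set.Ioo μ₁ μ₂, ∃ d : ℝ, ∀ h ∈ Set.Icc (-(13 * g + 1)) (13 * g + 1),
            q μ h - h ^ 2 / g =
                sSup ((fun h' : ℝ => q μ h' - h' ^ 2 / g) '' Set.Icc (-(13 * g + 1)) (13 * g + 1)) →
              HasDerivAt (fun μ' => q μ' h) d μ) ∧
          (∃ μm ∈ Set.Ioo μ₁ μ₂, ∃ μp ∈ Set.Ioo μ₁ μ₂, ∃ dm dp : ℝ, dm ≤ 1 - δ ∧ 1 - δ ≤ dp ∧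
            (∀ h ∈ Set.Icc (-(13 * g + 1)) (13 * g + 1),
              q μm h - h ^ 2 / g =
                  sSup ((fun h' : ℝ => q μm h' - h' ^ 2 / g) '' Set.Icc (-(13 * g + 1)) (13 * g + 1)) →
                HasDerivAt (fun μ' => q μ' h) dm μm) ∧
            (∀ h ∈ Set.Icc (-(13 * g + 1)) (13 * g + 1),
              q μp h - h ^ 2 / g =
                  sSup ((fun h' : ℝ => q μp h' - h' ^ 2 / g) '' Set.Icc (-(13 * g + 1)) (13 * g + 1)) →
                HasDerivAt (fun μ' => q μ' h) dp μp))) →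
    ∀ δ ∈ Set.Icc (1/10 : ℝ) (2/5 : ℝ), ∃ μ₁ μ₂ : ℝ, -4 < μ₁ ∧ μ₁ ≤ μ₂ ∧ μ₂ < 0 ∧
      ∃ a K' U₀ : ℝ, 0 < a ∧ 0 < K' ∧ 0 < U₀ ∧ ∀ U ∈ Set.Ioc (0 : ℝ) U₀,
        ∀ g ∈ Set.Icc (K' * U) (1 / 10),
        ∃ (b : ℝ → ℝ) (μm μp : ℝ),
          (∀ μ ∈ Set.Icc μ₁ μ₂, ∀ κ : ℝ, 0 < κ → ∃ L₀ : ℕ, ∀ (L : ℕ) [NeZero L], L₀ ≤ L →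
            |Real.log (Matrix.partitionFn (Real.exp (a / U)) (hubbardTorusWith 2 L 1 U μ -
                ((g / (L : ℝ) ^ 2 : ℝ) : ℂ) • ((pairField dWaveFormFactor L)ᴴ * pairField dWaveFormFactor L))).re /
                  (Real.exp (a / U) * (L : ℝ) ^ 2) - b μ| ≤ κ) ∧
          (∀ μ ∈ Set.Ioo μ₁ μ₂, DifferentiableAt ℝ b μ) ∧ μm ∈ Set.Ioo μ₁ μ₂ ∧ μp ∈ Set.Ioo μ₁ μ₂ ∧
          deriv b μm ≤ 1 - δ ∧ 1 - δ ≤ deriv b μp := by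
  intro hS3 hS1 hS4 δ hδ
  obtain ⟨μ₁, μ₂, hμ₁, hμ₁₂, hμ₂, a, K', U₀, ha, hK', hU₀, hreg⟩ := hS4 δ hδ
  refine ⟨μ₁, μ₂, hμ₁, hμ₁₂.le, hμ₂, a, K', U₀, ha, hK', hU₀, fun U hU g hg => ?_⟩
  set β : ℝ := Real.exp (a / U) with hβdef
  have hβ : 0 < β := Real.exp_pos _
  have hg0 : 0 < g := lt_of_lt_of_le (mul_pos hK' hU.1) hg.1
  set H : ℝ := 13 * g + 1 with hHdef
  have hH : 0 ≤ H := by positivity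
  -- the sourced limit, chosen globally (S3)
  choose qf hqf using fun μ h => hS3 β U μ h hβ
  -- regularity data (S4) for this limit
  obtain ⟨hDU, μm, hμm, μp, hμp, dm, dp, hdm, hdp, hMm, hMp⟩ :=
    hreg U hU g hg qf fun μ _ h _ => hqf μ h
  -- sequences `n ↦ p̃_{n+1}` for the inheritance lemmas
  have hseq : ∀ μ h : ℝ, ∀ κ : ℝ, 0 < κ → ∃ N : ℕ, ∀ n, N ≤ n →
      |Real.log (partitionFn β (dWaveSourceTorus (n + 1) U μ h)).re / (β * (((n + 1 : ℕ) : ℝ)) ^ 2) -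
        qf μ h| ≤ κ := by
    intro μ h κ hκ
    obtain ⟨L₀, hL₀⟩ := hqf μ h κ hκ
    exact ⟨L₀, fun n hn => hL₀ (n + 1) (by omega)⟩
  -- inherited convexity in `μ`
  have hconv : ∀ h ∈ Set.Icc (-H) H, ConvexOn ℝ Set.univ (fun μ => qf μ h) := by
    intro h _
    refine cfb_convexOn_univ_of_limit (f := fun n μ =>
      Real.log (partitionFn β (dWaveSourceTorus (n + 1) U μ h)).re / (β * (((n + 1 : ℕ) : ℝ)) ^ 2))
      (fun n => ?_) (fun μ κ hκ => hseq μ h κ hκ)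
    have := cfb_convexOn_sourcedPressure (n + 1) U h hβ
    simpa using this
  -- inherited Lipschitz bounds
  have hLμ : ∀ (μ μ' : ℝ), ∀ h ∈ Set.Icc (-H) H, |qf μ h - qf μ' h| ≤ 2 * |μ - μ'| := by
    intro μ μ' h _
    refine cfb_abs_sub_le_of_limits (hseq μ h) (hseq μ' h) fun n => ?_
    have := cfb_abs_sourcedPressure_sub_mu_le (n + 1) U h hβ μ μ'
    simpa using this
  have hLh : ∀ (μ : ℝ), ∀ h ∈ Set.Icc (-H) H, ∀ h' ∈ Set.Icc (-H) H,
      |qf μ h - qf μ h'| ≤ 8 * Real.sqrt 2 * |h - h'| := by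
    intro μ h _ h' _
    refine cfb_abs_sub_le_of_limits (hseq μ h) (hseq μ h') fun n => ?_
    have := abs_sourcedPressure_sub_le (n + 1) U μ hβ h h'
    simpa using this
  -- Danskin (S1) at any point with a given common slope
  have hDan : ∀ μ₀ d : ℝ, (∀ h ∈ Set.Icc (-H) H,
      qf μ₀ h - h ^ 2 / g = sSup ((fun h' : ℝ => qf μ₀ h' - h' ^ 2 / g) '' Set.Icc (-H) H) →
        HasDerivAt (fun μ => qf μ h) d μ₀) →
      HasDerivAt (fun μ => sSup ((fun h' : ℝ => qf μ h' - h' ^ 2 / g) '' Set.Icc (-H) H)) d μ₀ :=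
    fun μ₀ d hm => hS1 qf H g 2 (8 * Real.sqrt 2) μ₀ d hH hconv hLμ hLh hm
  refine ⟨fun μ => sSup ((fun h' : ℝ => qf μ h' - h' ^ 2 / g) '' Set.Icc (-H) H), μm, μp,
    fun μ _ κ hκ => ?_, fun μ hμ => ?_, hμm, hμp, ?_, ?_⟩
  · -- (TDL) of the seeded pressure at `β`, by AHM + the sourced limit
    exact tw_seededPressureLimit_of_sourcedLimit U g β μ (qf μ) hβ hg0
      (twApproximatingHamiltonian_proof U μ β g hβ hg0) (fun h _ => hqf μ h) κ hκ
  · -- (DIFF)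
    obtain ⟨d, hd⟩ := hDU μ hμ
    exact (hDan μ d hd).differentiableAt
  · -- (EDGE) at `μm`
    rw [(hDan μm dm hMm).deriv]; exact hdm
  · -- (EDGE) at `μp`
    rw [(hDan μp dp hMp).deriv]; exact hdp

end

end Summit.HubbardSuperconductivity.HubbardSuperconductivity.Theorems.TwSeededEnsembleEquivalenceR.ColdFloorLine
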